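import Summits.FinalStateConjecture.FinalStateConjecture.Theses.PhaseMixingCapture

/-!
# `CaptureSuffices` (crux `stmt-FinalStateConjecture-9953`, route `PhaseMixingCapture`):
# naked and exposed-edge members of the capture basins — thresholds and exponent bookkeeping

Negative-side support file of the crux disprover (cdisprove seat, cycle 2), part 1 of 2 (part 2:
`NakedMembers.lean`, which carries the full discussion). No definitions, no named facts,
`sorry`-free. Elementary facts about the one-parameter **mass family at fixed spin**
`M' ↦ Kerr.data M' a r₀` inside the basins of the capture items 10606/10696:

* §1 `rPlus_lt_iff`: the outer horizon `r₊(M', a) = M' + √(M'² − a²)` of the member of mass `M'`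
  lies strictly below the truncation radius `r₀` of the slice (`|a| < r₀`) iff
  `M' < (r₀² + a²)/(2r₀)`; at the items' radius `r₀ = M` this threshold is `M − Mχ/2`,
  `χ = 1 − (a/M)²` (`edge_threshold_eq`); the window of SUB-extremal masses with exposed edge
  `(|a|, M − Mχ/2)` is non-empty for every sub-extremal `(M, a)` (`abs_lt_edge_threshold`); the
  extremal member `M' = |a|`, where the overspinning (horizonless) segment of the family starts,
  sits at mass defect `M − |a| ∈ [Mχ/2, Mχ]` (`defect_extremal_bounds`).
* §2 `exists_chi_linear_lt_rpow`: for `γ < 1` every basin `c·χ^γ`, however small `c`, exceeds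
  `K·χ`, however large `K`, for suitably small `χ`; `basin_le_half_defect_of_one_le`: for `γ ≥ 1`
  and `c ≤ K'M/2` it never exceeds `K'·Mχ/2`. With distances along the family `≍ K·|M − M'|`
  (un-pinned topologies, `δ < -1/2`) this is the dichotomy "`γ < 1` swallows naked members /
  `γ ≥ 1` can avoid them" used in part 2.
-/

-- the problem namespace `FinalStateConjecture.FinalStateConjecture` (single-conjunct summit) trips dupNamespace
set_option linter.dupNamespace false

noncomputable section

open scoped Manifold ContDiff Topology ENNReal
open Set Filter MeasureTheory

namespace Summit.FinalStateConjecture.FinalStateConjecture.Theorems.CaptureSuffices.Negative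

open Literature.Geometry.Lorentzian

/-! ## §1 Where the outer horizon of a member of the mass family sits relative to the slice edge -/

/-- **Horizon-below-edge criterion.** For `|a| < r₀`, the outer horizon radius
`Kerr.rPlus M' a = M' + √(M'² − a²)` of the Kerr–Schild spacetime `(M', a)` lies strictly below
the truncation radius `r₀` of the slice `Kerr.slice a r₀` iff `M' < (r₀² + a²)/(2r₀)`. (For an
overspinning parameter `M' < |a|` the radicand is negative, `Real.sqrt` returns `0`,
`Kerr.rPlus M' a = M'`, and both sides hold: `M' < |a| ≤ (r₀² + a²)/(2r₀)` by AM–GM.) -/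
theorem rPlus_lt_iff {M' a r₀ : ℝ} (hr : |a| < r₀) :
    Kerr.rPlus M' a < r₀ ↔ M' < (r₀ ^ 2 + a ^ 2) / (2 * r₀) := by
  have hr0 : 0 < r₀ := lt_of_le_of_lt (abs_nonneg a) hr
  have ha2 : a ^ 2 < r₀ ^ 2 := by nlinarith [abs_nonneg a, sq_abs a, hr]
  unfold Kerr.rPlus
  rw [lt_div_iff₀ (by positivity)]
  constructor
  · intro h
    have hM'r : M' < r₀ := by nlinarith [Real.sqrt_nonneg (M' ^ 2 - a ^ 2)]
    have h2 : √(M' ^ 2 - a ^ 2) < r₀ - M' := by linarith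
    rw [Real.sqrt_lt' (by linarith)] at h2
    nlinarith
  · intro h
    have hM'r : M' < r₀ := by nlinarith
    have h2 : √(M' ^ 2 - a ^ 2) < r₀ - M' := by
      rw [Real.sqrt_lt' (by linarith)]
      nlinarith
    linarith

/-- **The threshold at the items' truncation radius `r₀ = M`** is `(M² + a²)/(2M) = M − Mχ/2`
with `χ = 1 − (a/M)²`: a member's outer horizon drops below the slice edge exactly when its mass
defect `M − M'` exceeds `Mχ/2` (half the sub-extremality factor of the items, times `M`). -/
theorem edge_threshold_eq {M : ℝ} (hM : M ≠ 0) (a : ℝ) :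
    (M ^ 2 + a ^ 2) / (2 * M) = M - M * (1 - (a / M) ^ 2) / 2 := by
  field_simp
  ring

/-- **The exposed-edge sub-extremal window is never empty.** For sub-extremal `(M, a)` the open
interval of SUB-extremal masses `M' ∈ (|a|, (M² + a²)/(2M))` whose outer horizon lies below the
edge `r = M` is non-empty: `(M² + a²)/(2M) − |a| = (M − |a|)²/(2M) > 0` (strict AM–GM). -/
theorem abs_lt_edge_threshold {M a : ℝ} (hM : 0 < M) (h : Kerr.IsSubextremal M a) :
    |a| < (M ^ 2 + a ^ 2) / (2 * M) := by
  unfold Kerr.IsSubextremal at h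
  rw [lt_div_iff₀ (by positivity)]
  nlinarith [sq_pos_of_pos (sub_pos.2 h), sq_abs a, abs_nonneg a]

/-- **Where the naked segment starts.** The extremal member `M' = |a|` of the mass family (below
it every member is an overspinning, horizonless Kerr–Schild datum) sits at mass defect
`M − |a|` with `Mχ/2 ≤ M − |a| ≤ Mχ`, `χ = 1 − (a/M)²` (`Mχ = (M − |a|)(M + |a|)/M`). -/
theorem defect_extremal_bounds {M a : ℝ} (hM : 0 < M) (ha : |a| ≤ M) :
    M * (1 - (a / M) ^ 2) ≤ 2 * (M - |a|) ∧ M - |a| ≤ M * (1 - (a / M) ^ 2) := by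
  have hb := abs_nonneg a
  have e : M * (1 - (a / M) ^ 2) = (M - |a|) * (M + |a|) / M := by
    have : (a / M) ^ 2 = |a| ^ 2 / M ^ 2 := by rw [div_pow, sq_abs]
    rw [this]
    field_simp
    ring
  rw [e, div_le_iff₀ hM, le_div_iff₀ hM]
  constructor
  · nlinarith [sq_nonneg (M - |a|)]
  · nlinarith [mul_nonneg (sub_nonneg.2 ha) hb]

/-! ## §2 Exponent bookkeeping: `γ < 1` swallows the naked segment, `γ ≥ 1` can avoid it -/

/-- **`γ < 1`: every basin `c·χ^γ` eventually swallows members at distance `≍ χ`.** For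
`γ < 1` and all `K, c > 0` — however large `K`, however small `c` — there are arbitrarily small
`χ ∈ (0, 1]` with `K·χ < c·χ^γ`. -/
theorem exists_chi_linear_lt_rpow {γ : ℝ} (hγ : γ < 1) {K c χ₀ : ℝ} (hK : 0 < K) (hc : 0 < c)
    (hχ₀ : 0 < χ₀) : ∃ χ : ℝ, 0 < χ ∧ χ < χ₀ ∧ χ ≤ 1 ∧ K * χ < c * χ ^ γ := by
  have h1γ : 0 < 1 - γ := by linarith
  set t : ℝ := (c / (2 * K)) ^ (1 - γ)⁻¹ with ht
  have ht0 : 0 < t := Real.rpow_pos_of_pos (by positivity) _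
  set χ : ℝ := min (χ₀ / 2) (min 1 t) with hχ
  have hχ0 : 0 < χ := lt_min (by positivity) (lt_min one_pos ht0)
  refine ⟨χ, hχ0, lt_of_le_of_lt (min_le_left _ _) (by linarith),
    le_trans (min_le_right _ _) (min_le_left _ _), ?_⟩
  have hχt : χ ≤ t := le_trans (min_le_right _ _) (min_le_right _ _)
  have hpow : χ ^ (1 - γ) ≤ c / (2 * K) := by
    calc χ ^ (1 - γ) ≤ t ^ (1 - γ) := Real.rpow_le_rpow hχ0.le hχt h1γ.le
      _ = c / (2 * K) := by rw [ht, Real.rpow_inv_rpow (by positivity) h1γ.ne']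
  have hsplit : χ ^ (1 - γ) * χ ^ γ = χ := by
    rw [← Real.rpow_add hχ0]
    simp
  have hχγ : 0 < χ ^ γ := Real.rpow_pos_of_pos hχ0 _
  have hcχ : 0 < c * χ ^ γ := mul_pos hc hχγ
  calc K * χ = (K * χ ^ (1 - γ)) * χ ^ γ := by rw [mul_assoc, hsplit]
    _ ≤ (K * (c / (2 * K))) * χ ^ γ := by gcongr
    _ = (c / 2) * χ ^ γ := by field_simp
    _ < c * χ ^ γ := by linarith

/-- **`γ ≥ 1`: a small enough constant clears the threshold** (tightness of the ceiling inside
the mass family). For `γ ≥ 1`, `0 < χ ≤ 1` and `0 ≤ c ≤ K'M/2`: `c·χ^γ ≤ K'·(Mχ/2)` — a basin of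
radius `c·χ^γ` stops short of every member whose distance is at least `K'` times a mass defect
`≥ Mχ/2`, i.e. of the whole exposed-edge and naked part of the family. -/
theorem basin_le_half_defect_of_one_le {γ : ℝ} (hγ : 1 ≤ γ) {c K' M χ : ℝ} (hc : 0 ≤ c)
    (hcK : c ≤ K' * M / 2) (hχ0 : 0 < χ) (hχ1 : χ ≤ 1) : c * χ ^ γ ≤ K' * (M * χ / 2) := by
  have h1 : χ ^ γ ≤ χ := by
    calc χ ^ γ ≤ χ ^ (1 : ℝ) := Real.rpow_le_rpow_of_exponent_ge hχ0 hχ1 hγ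
      _ = χ := Real.rpow_one χ
  calc c * χ ^ γ ≤ c * χ := mul_le_mul_of_nonneg_left h1 hc
    _ ≤ K' * M / 2 * χ := mul_le_mul_of_nonneg_right hcK hχ0.le
    _ = K' * (M * χ / 2) := by ring

end Summit.FinalStateConjecture.FinalStateConjecture.Theorems.CaptureSuffices.Negative
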